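import Literature.Computability.QuantumComplexity.IQPSimulationTransfer
import Literature.Computability.Complexity.CountingHierarchyPH
import Literature.Computability.Complexity.PairPlumbing
import Literature.Computability.Complexity.BPPErrorReduction
import Literature.Computability.Complexity.LengthCompare
import HarnessLib

/-!
# A post-selected uniform sampler is a post-BPP computation (discharge of `mem_PostBPPWith_of_samplerPostDecides`)

Family `quantum-advantage`; trunk material `CplxCore`. This file proves the named fact
`Literature.Computability.QuantumComplexity.mem_PostBPPWith_of_samplerPostDecides` of `IQPSimulationTransfer.lean`
(`mem_PostBPPWith_of_samplerPostDecides_holds`), the definition-level plumbing step in the tree's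
DAG for Bremner–Jozsa–Shepherd's Thm. 2 / Cor. 1 (Proc. R. Soc. A 467 (2011), arXiv:1005.1407):
if a *uniform* PPT sampler `A` (`IsPPT A id`, coin budget exactly a polynomial `q`), post-selected
on the IQP register events (`iqpPostselectStrings |x| (k |x|)`, `iqpAcceptStrings |x|`) with a
unary polynomial-time block size `k`, decides `L` with tolerance `ε` (`Sampler.PostDecides`), then
`L ∈ PostBPPWith ε`. In BJS's words (proof of Thm. 2, p. 8): the simulating process is "a uniform
family of classical randomised circuits `C̃_w`" whose registers `Õ_w`, `P̃_w` "correspond to"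
those of `C_w`, i.e. a post-BPP computation in the sense of Def. 3 — in the tree's random-string
form of `PostBPP` (Han–Hemaspaandra–Thierauf's `BPP_path`; Aaronson 2005, §2) this asks for the
two predicates "`A(x, r)` post-selects" and "`A(x, r)` accepts" on `⟨x, r⟩` to be in `P` and for
`Pr_r` over `r ∈ {0,1}^{q|x|}` to be the output law of `A`.

## The argument, as formalised

* The sampler as a string map `runPairFn A : ⟨x, r⟩ ↦ ⟨x, A(x, r)⟩` is in `FP`: copy the input
  (`copyFn`), project the first copy (`mapFstFn`), run `A` on the second (`mapSndFn` of
  `uncurry A.run ∘ boolUnpair`, polynomial-time by `IsPPT` and the re-pairing machine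
  `polyTimeComputable_boolUnpair`) — the composition pattern of `ProofSystemsProofs.lean`.
* The register events as languages of pairs `⟨x, y⟩` in `P`: the output wire
  (`accRegLang = {⟨x,y⟩ | y.getD |x| = 1}`: drop `|x|` symbols, `dropSndFn X`, then
  `sndStartsWith 1`), the input wires (`inputRegLang`: keep `|x|` symbols, `truncSndFn X`, then the
  regular language "no `1`", `noTrueT`), and the ancilla block (`ancRegLang k`: drop `|x|+1`,
  replace the first component by `1^{k|x|}` — an `FP` map by uniformity of `k` and the all-ones
  map `onesFn` of `PairPlumbing.lean` — keep `k|x|`, then "no `1`").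
* `Pr_r[⟨x,r⟩ ∈ S]` for `S = runPairFn A ⁻¹' (post-selection language)` is the `outputPMF`
  probability of the event (`RandAlg.pr_eq_uniformProb`, `BPPErrorReduction.lean`), using the
  exact coin budget `coinLen = q`.

## Contents

* `noTrueT` (`noTrue_mem_P`), `unaryLenFn_mem_FP` (from `onesFn_mem_FP`);
  list lemmas `not_true_mem_iff_getD`, `not_true_mem_take_drop_iff`, `head?_drop_eq_some_true_iff`;
* `runPairFn` (`runPairFn_boolPair`, `runPairFn_mem_FP`);
* `accRegLang`, `inputRegLang`, `ancRegLang`, `postRegLang`, `samplerPostLang`, `samplerAccLang`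
  (`_mem_P`, `boolPair_mem_…`), and `mem_PostBPPWith_of_samplerPostDecides_holds`.

## References

* M. J. Bremner, R. Jozsa, D. J. Shepherd, *Classical simulation of commuting quantum
  computations implies collapse of the polynomial hierarchy*, Proc. R. Soc. A 467 (2011)
  459–472, arXiv:1005.1407: Def. 1 (uniform families), Def. 3 (post-BPP), Thm. 2 (proof, p. 8,
  eq. (7): the registers `Õ_w`, `P̃_w` of the simulating randomised family).
* Y. Han, L. A. Hemaspaandra, T. Thierauf, *Threshold computation and cryptographic security*,
  SIAM J. Comput. 26 (1997), Def. 2.2 (`BPP_path`).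
* S. Arora, B. Barak, *Computational Complexity: A Modern Approach*, CUP 2009, Def. 7.1
  (PTMs as deterministic machines on `(x, r)`), §1.3 and Thm. 2.8 (closure under composition).
* Mathlib: `PMF.toOuterMeasure_map_apply`, `Computability.unaryEncodeNat`.
-/

namespace Literature.Computability.QuantumComplexity

open _root_.Computability

/-! ### The regular language "no `1`" -/

/-- Transducer deciding `{w | 1 ∉ w}`: the state records whether a `1` has been read; the verdict
is emitted by `front`, the body discarded. [Hopcroft–Ullman 1979, §2.7] [folklore] -/
def noTrueT : Complexity.FST Bool Bool Bool where
  init := false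
  step := fun s b => (s || b, [])
  front := fun s => [!s]
  keep := fun _ => false

/-- The transition of `noTrueT` (definitional). [folklore] -/
@[simp] theorem noTrueT_step (s b : Bool) : noTrueT.step s b = (s || b, []) := rfl

/-- The run of `noTrueT` ORs the symbols into the state. [folklore] -/
theorem noTrueT_run (s : Bool) (w : List Bool) :
    (noTrueT.run s w).1 = (s || decide (true ∈ w)) := by
  induction w generalizing s with
  | nil => simp
  | cons b w ih =>
    rw [Complexity.FST.run_cons, noTrueT_step, ih]
    cases s <;> cases b <;> simp

/-- `noTrueT` decides `{w | 1 ∉ w}`. [folklore] -/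
theorem noTrueT_eval (w : List Bool) : noTrueT.eval w = [decide (true ∉ w)] := by
  have h := noTrueT_run false w
  simp only [Complexity.FST.eval, show noTrueT.init = false from rfl, show ∀ s, noTrueT.keep s = false from
    fun _ => rfl, show ∀ s, noTrueT.front s = [!s] from fun _ => rfl, h]
  simp

/-- **`{w | 1 ∉ w} ∈ P`** (a regular language). [Arora–Barak 2009, Def. 1.13] [folklore] -/
theorem noTrue_mem_P : ({w | true ∉ w} : Language Bool) ∈ Complexity.Classes.P :=
  Complexity.mem_P_of_mem_FP noTrueT.polyTimeComputable_eval _ fun w =>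
    ⟨fun h => by rw [noTrueT_eval, decide_eq_true (show true ∉ w from h)],
     fun h => by rw [noTrueT_eval, decide_eq_false (show ¬ (true ∉ w) from h)]⟩

/-! ### List lemmas on `getD` -/

/-- A bit string has no `1` iff it reads `0` at every position (out of range: default `0`).
[folklore] -/
theorem not_true_mem_iff_getD (L : List Bool) : true ∉ L ↔ ∀ i : ℕ, L.getD i false = false := by
  constructor
  · intro h i
    rw [List.getD_eq_getElem?_getD]
    cases hi : L[i]? with
    | none => rfl
    | some b =>
      have hb : b ∈ L := List.mem_of_getElem? hi
      cases b
      · rfl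
      · exact absurd hb h
  · intro h hmem
    obtain ⟨i, hi, hval⟩ := List.mem_iff_getElem.1 hmem
    have := h i
    rw [List.getD_eq_getElem?_getD, List.getElem?_eq_getElem hi, hval] at this
    exact Bool.noConfusion this

/-- Reading the window `l[a, a+n)`. [folklore] -/
theorem getD_take_drop (l : List Bool) (a n i : ℕ) :
    ((l.drop a).take n).getD i false = if i < n then l.getD (a + i) false else false := by
  rw [List.getD_eq_getElem?_getD, List.getElem?_take]
  split_ifs with h
  · rw [List.getElem?_drop, List.getD_eq_getElem?_getD]
  · rfl

/-- The window `l[a, a+n)` has no `1` iff `l` reads `0` at the positions `a, …, a+n-1`.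
[folklore] -/
theorem not_true_mem_take_drop_iff (l : List Bool) (a n : ℕ) :
    true ∉ (l.drop a).take n ↔ ∀ j < n, l.getD (a + j) false = false := by
  rw [not_true_mem_iff_getD]
  constructor
  · intro h j hj
    have := h j
    rwa [getD_take_drop, if_pos hj] at this
  · intro h i
    rw [getD_take_drop]
    split_ifs with hi
    · exact h i hi
    · rfl

/-- `l.drop a` starts with `1` iff `l` reads `1` at position `a`. [folklore] -/
theorem head?_drop_eq_some_true_iff (l : List Bool) (a : ℕ) :
    (l.drop a).head? = some true ↔ l.getD a false = true := by
  rw [List.head?_drop, List.getD_eq_getElem?_getD]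
  cases l[a]? with
  | none => simp
  | some b => simp

/-! ### Unary length maps -/

/-- **`x ↦ 1^{k |x|}` is in `FP`** for a unary polynomial-time `k` (compose the length map with
the machine of `k`; the length map is `onesFn_mem_FP` of `PairPlumbing.lean`).
[Arora–Barak 2009, §1.3, Thm. 2.8 (proof)] [folklore] -/
theorem unaryLenFn_mem_FP {k : ℕ → ℕ} (hk : Complexity.PolyTimeComputable unaryEncodeNat unaryEncodeNat k) :
    (fun x : List Bool => unaryEncodeNat (k x.length)) ∈ Complexity.FP := by
  -- `onesFn w = unaryEncodeNat |w|` (`PairPlumbing.lean`) is the length map into unary naturals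
  have h1 : Complexity.PolyTimeComputable (id : List Bool → List Bool) unaryEncodeNat (List.length : List Bool → ℕ) := by
    obtain ⟨p, M, hM⟩ := Complexity.onesFn_mem_FP
    exact ⟨p, M, fun w => hM w⟩
  obtain ⟨p, M, hM⟩ := Complexity.PolyTimeComputable.comp_holds hk h1
  exact ⟨p, M, fun w => hM w⟩

/-! ### The sampler as a string map -/

/-- **`runPairFn A : ⟨x, r⟩ ↦ ⟨x, A(x, r)⟩`**: copy the input, project the first copy to `x`, run
`A` on the second copy. (Arora–Barak 2009, Def. 7.1: a PTM as a deterministic machine on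
`(x, r)`; composition as in Thm. 2.8.) [folklore] -/
noncomputable def runPairFn (A : Complexity.RandAlg (List Bool) (List Bool)) : List Bool → List Bool :=
  Complexity.mapSndFn (Function.uncurry A.run ∘ Complexity.boolUnpair) ∘ Complexity.mapFstFn (fun z => (Complexity.boolUnpair z).1) ∘ Complexity.copyFn

/-- `runPairFn A ⟨x, r⟩ = ⟨x, A.run x r⟩`. [folklore] -/
@[simp] theorem runPairFn_boolPair (A : Complexity.RandAlg (List Bool) (List Bool)) (x r : List Bool) :
    runPairFn A (Complexity.boolPair x r) = Complexity.boolPair x (A.run x r) := by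
  simp [runPairFn, Complexity.copyFn_apply]

/-- **`runPairFn A ∈ FP` for a PPT `A`** (`IsPPT A id`: `uncurry A.run` is polynomial-time on
`boolPair x r`; precompose the re-pairing machine `polyTimeComputable_boolUnpair`).
[Arora–Barak 2009, Def. 7.1, Thm. 2.8 (proof)] [folklore] -/
theorem runPairFn_mem_FP {A : Complexity.RandAlg (List Bool) (List Bool)} (hA : Literature.Computability.Cryptography.IsPPT A id) :
    runPairFn A ∈ Complexity.FP :=
  Complexity.comp_mem_FP (Complexity.mapSndFn_mem_FP (Complexity.PolyTimeComputable.comp_holds hA.1 Complexity.polyTimeComputable_boolUnpair))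
    (Complexity.comp_mem_FP (Complexity.mapFstFn_mem_FP Complexity.boolUnpairFst_mem_FP) Complexity.copyFn_mem_FP)

attribute [irreducible] runPairFn

end Literature.Computability.QuantumComplexity

namespace Literature.Computability.QuantumComplexity

open _root_.Computability Complexity Complexity.Classes Cryptography Polynomial

/-! ### The register events as languages of pairs -/

/-- **The output-wire language** `{⟨x, y⟩ | y.getD |x| 0 = 1}` (BJS: `O_w = 1`; the tree's
`iqpAcceptStrings |x|`), presented as: drop `|x|` symbols of `y`, then the second component starts
with `1`. (BJS 2011, Def. 3 (i).) [cite: BremnerJozsaShepherdPRSA2011, Def. 3] -/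
noncomputable def accRegLang : Language Bool :=
  {w | dropSndFn X w ∈ sndStartsWith true}

/-- `accRegLang ∈ P`. [Arora–Barak 2009, Thm. 2.8 (proof)] [folklore] -/
theorem accRegLang_mem_P : accRegLang ∈ P :=
  preimage_mem_P (f := dropSndFn X) (sndStartsWith_mem_P true) (dropSndFn_mem_FP X)

/-- Membership of a pair in `accRegLang`: the output wire reads `1`. [folklore] -/
theorem boolPair_mem_accRegLang (x y : List Bool) :
    boolPair x y ∈ accRegLang ↔ y ∈ iqpAcceptStrings x.length := by
  show dropSndFn X (boolPair x y) ∈ sndStartsWith true ↔ y.getD x.length false = true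
  rw [dropSndFn_boolPair, boolPair_mem_sndStartsWith, eval_X, head?_drop_eq_some_true_iff]

/-- **The input-register language** `{⟨x, y⟩ | ∀ i < |x|, y.getD i 0 = 0}` (the input wires read
`0…0`), presented as: keep `|x|` symbols of `y`, then "no `1`". (BJS 2011, §2.4 and Def. 3: the
post-selection pattern `0…0`.) [cite: BremnerJozsaShepherdPRSA2011, §2.4 and Def. 3] -/
noncomputable def inputRegLang : Language Bool :=
  {w | true ∉ (boolUnpair (truncSndFn X w)).2}

/-- `inputRegLang ∈ P`. [Arora–Barak 2009, Thm. 2.8 (proof)] [folklore] -/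
theorem inputRegLang_mem_P : inputRegLang ∈ P :=
  preimage_mem_P (f := (fun z => (boolUnpair z).2) ∘ truncSndFn X) noTrue_mem_P
    (comp_mem_FP boolUnpairSnd_mem_FP (truncSndFn_mem_FP X))

/-- Membership of a pair in `inputRegLang`: the input wires read `0…0`. [folklore] -/
theorem boolPair_mem_inputRegLang (x y : List Bool) :
    boolPair x y ∈ inputRegLang ↔ ∀ i < x.length, y.getD i false = false := by
  show true ∉ (boolUnpair (truncSndFn X (boolPair x y))).2 ↔ _
  rw [truncSndFn_boolPair, boolUnpair_boolPair, eval_X]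
  have h := not_true_mem_take_drop_iff y 0 x.length
  rw [List.drop_zero] at h
  simpa using h

/-- **The ancilla-block language** `{⟨x, y⟩ | ∀ j < k |x|, y.getD (|x|+1+j) 0 = 0}` (the
post-selected ancillas `|x|+1, …, |x|+k|x|` read `0…0`), presented as: drop `|x|+1` symbols of `y`,
replace `x` by `1^{k|x|}`, keep `k|x|` symbols, then "no `1`". (BJS 2011, §2.4 and Def. 3.) [cite: BremnerJozsaShepherdPRSA2011, §2.4 and Def. 3] -/
noncomputable def ancRegLang (k : ℕ → ℕ) : Language Bool :=
  {w | true ∉ (boolUnpair (truncSndFn X (mapFstFn (fun x : List Bool => unaryEncodeNat (k x.length))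
    (dropSndFn (X + 1) w)))).2}

/-- `ancRegLang k ∈ P` for a unary polynomial-time block size `k`.
[Arora–Barak 2009, Thm. 2.8 (proof)] [folklore] -/
theorem ancRegLang_mem_P {k : ℕ → ℕ} (hk : PolyTimeComputable unaryEncodeNat unaryEncodeNat k) :
    ancRegLang k ∈ P :=
  preimage_mem_P (f := (fun z => (boolUnpair z).2) ∘ truncSndFn X ∘
      mapFstFn (fun x : List Bool => unaryEncodeNat (k x.length)) ∘ dropSndFn (X + 1)) noTrue_mem_P
    (comp_mem_FP boolUnpairSnd_mem_FP (comp_mem_FP (truncSndFn_mem_FP X)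
      (comp_mem_FP (mapFstFn_mem_FP (unaryLenFn_mem_FP hk)) (dropSndFn_mem_FP (X + 1)))))

/-- Membership of a pair in `ancRegLang k`: the ancilla block reads `0…0`. [folklore] -/
theorem boolPair_mem_ancRegLang (k : ℕ → ℕ) (x y : List Bool) :
    boolPair x y ∈ ancRegLang k ↔ ∀ j < k x.length, y.getD (x.length + 1 + j) false = false := by
  show true ∉ (boolUnpair (truncSndFn X (mapFstFn (fun x : List Bool => unaryEncodeNat (k x.length))
    (dropSndFn (X + 1) (boolPair x y))))).2 ↔ _
  have e : (unaryEncodeNat (k x.length)).length = k x.length := unary_decode_encode_nat _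
  rw [dropSndFn_boolPair, mapFstFn_boolPair, truncSndFn_boolPair, boolUnpair_boolPair, eval_X,
    e, eval_add, eval_X, eval_one, not_true_mem_take_drop_iff]

/-- **The post-selection language** of pairs: input wires and ancilla block read `0…0`
(BJS: `P_w = 0…0`; the tree's `iqpPostselectStrings |x| (k|x|)`). (BJS 2011, Def. 3 (ii) and
§2.4.) [cite: BremnerJozsaShepherdPRSA2011, Def. 3 and §2.4] -/
noncomputable def postRegLang (k : ℕ → ℕ) : Language Bool :=
  inputRegLang ⊓ ancRegLang k

/-- `postRegLang k ∈ P`. [Arora–Barak 2009, Thm. 2.8 (proof)] [folklore] -/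
theorem postRegLang_mem_P {k : ℕ → ℕ} (hk : PolyTimeComputable unaryEncodeNat unaryEncodeNat k) :
    postRegLang k ∈ P :=
  inter_mem_P inputRegLang_mem_P (ancRegLang_mem_P hk)

/-- Membership of a pair in `postRegLang k` is membership of the second component in
`iqpPostselectStrings`. [folklore] -/
theorem boolPair_mem_postRegLang (k : ℕ → ℕ) (x y : List Bool) :
    boolPair x y ∈ postRegLang k ↔ y ∈ iqpPostselectStrings x.length (k x.length) := by
  show boolPair x y ∈ inputRegLang ∧ boolPair x y ∈ ancRegLang k ↔
    (∀ i < x.length, y.getD i false = false) ∧ ∀ j < k x.length, y.getD (x.length + 1 + j) false = false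
  rw [boolPair_mem_inputRegLang, boolPair_mem_ancRegLang]

/-! ### The sampler's two predicates -/

/-- **`S = {⟨x, r⟩ | A(x, r) post-selects}`** (BJS's `P̃_w = 0…0` as a predicate on input and
coins). (BJS 2011, proof of Thm. 2, eq. (7).) [cite: BremnerJozsaShepherdPRSA2011, Thm. 2 (proof, eq. (7))] -/
noncomputable def samplerPostLang (A : RandAlg (List Bool) (List Bool)) (k : ℕ → ℕ) : Language Bool :=
  {w | runPairFn A w ∈ postRegLang k}

/-- **`R = {⟨x, r⟩ | A(x, r) accepts}`** (BJS's `Õ_w = 1` as a predicate on input and coins).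
(BJS 2011, proof of Thm. 2, eq. (7).) [cite: BremnerJozsaShepherdPRSA2011, Thm. 2 (proof, eq. (7))] -/
noncomputable def samplerAccLang (A : RandAlg (List Bool) (List Bool)) : Language Bool :=
  {w | runPairFn A w ∈ accRegLang}

/-- `S ∈ P` for a PPT sampler and a uniform block size. [Arora–Barak 2009, Thm. 2.8 (proof)]
[folklore] -/
theorem samplerPostLang_mem_P {A : RandAlg (List Bool) (List Bool)} {k : ℕ → ℕ} (hA : IsPPT A id)
    (hk : PolyTimeComputable unaryEncodeNat unaryEncodeNat k) : samplerPostLang A k ∈ P :=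
  preimage_mem_P (f := runPairFn A) (postRegLang_mem_P hk) (runPairFn_mem_FP hA)

/-- `R ∈ P` for a PPT sampler. [Arora–Barak 2009, Thm. 2.8 (proof)] [folklore] -/
theorem samplerAccLang_mem_P {A : RandAlg (List Bool) (List Bool)} (hA : IsPPT A id) :
    samplerAccLang A ∈ P :=
  preimage_mem_P (f := runPairFn A) accRegLang_mem_P (runPairFn_mem_FP hA)

/-- Membership in `samplerPostLang` (definitional). [folklore] -/
theorem mem_samplerPostLang (A : RandAlg (List Bool) (List Bool)) (k : ℕ → ℕ) (w : List Bool) :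
    w ∈ samplerPostLang A k ↔ runPairFn A w ∈ postRegLang k := Iff.rfl

/-- Membership in `samplerAccLang` (definitional). [folklore] -/
theorem mem_samplerAccLang (A : RandAlg (List Bool) (List Bool)) (w : List Bool) :
    w ∈ samplerAccLang A ↔ runPairFn A w ∈ accRegLang := Iff.rfl

/-- `⟨x, r⟩ ∈ S ↔ A.run x r ∈ iqpPostselectStrings |x| (k|x|)`. [folklore] -/
theorem boolPair_mem_samplerPostLang (A : RandAlg (List Bool) (List Bool)) (k : ℕ → ℕ) (x r : List Bool) :
    boolPair x r ∈ samplerPostLang A k ↔ A.run x r ∈ iqpPostselectStrings x.length (k x.length) := by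
  rw [mem_samplerPostLang, runPairFn_boolPair, boolPair_mem_postRegLang]

/-- `⟨x, r⟩ ∈ R ↔ A.run x r ∈ iqpAcceptStrings |x|`. [folklore] -/
theorem boolPair_mem_samplerAccLang (A : RandAlg (List Bool) (List Bool)) (x r : List Bool) :
    boolPair x r ∈ samplerAccLang A ↔ A.run x r ∈ iqpAcceptStrings x.length := by
  rw [mem_samplerAccLang, runPairFn_boolPair, boolPair_mem_accRegLang]

/-! ### The discharge -/

/-- **Discharge of `mem_PostBPPWith_of_samplerPostDecides`.** Take `R = samplerAccLang A`,
`S = samplerPostLang A k` (both in `P`) and the coin polynomial `p = q`; by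
`RandAlg.pr_eq_uniformProb` and `coinLen = q`, `Pr_r[⟨x,r⟩ ∈ S]` and
`Pr_r[⟨x,r⟩ ∈ S ∧ ⟨x,r⟩ ∈ R]` are literally `Sampler.postselectProb A k x` and
`Sampler.jointAcceptProb A k x`, so `Sampler.PostDecides A k L ε` is membership in `PostBPPWith ε`.
(BJS 2011, proof of Thm. 2 with Def. 1 and Def. 3.) [cite: BremnerJozsaShepherdPRSA2011, Thm. 2 (proof, eq. (7)) with Def. 3] -/
theorem mem_PostBPPWith_of_samplerPostDecides_holds : mem_PostBPPWith_of_samplerPostDecides := by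
  intro L ε k A hk hA hq hdec
  obtain ⟨q, hq⟩ := hq
  refine ⟨samplerAccLang A, samplerAccLang_mem_P hA, samplerPostLang A k, samplerPostLang_mem_P hA hk,
    q, fun x => ?_⟩
  obtain ⟨hpos, hyes, hno⟩ := hdec x
  have hS : uniformProb (q.eval x.length) {r | boolPair x r ∈ samplerPostLang A k} =
      Sampler.postselectProb A k x := by
    rw [Sampler.postselectProb, show ((A.outputPMF id x).toOuterMeasure
      (iqpPostselectStrings x.length (k x.length))).toReal = A.pr id x _ from rfl,
      RandAlg.pr_eq_uniformProb, hq]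
    simp only [id_eq, boolPair_mem_samplerPostLang]
  have hSR : uniformProb (q.eval x.length)
      {r | boolPair x r ∈ samplerPostLang A k ∧ boolPair x r ∈ samplerAccLang A} =
      Sampler.jointAcceptProb A k x := by
    rw [Sampler.jointAcceptProb, show ((A.outputPMF id x).toOuterMeasure
      (iqpAcceptStrings x.length ∩ iqpPostselectStrings x.length (k x.length))).toReal = A.pr id x _ from rfl,
      RandAlg.pr_eq_uniformProb, hq]
    simp only [id_eq]
    congr 1
    ext r
    simp only [Set.mem_setOf_eq, boolPair_mem_samplerPostLang, boolPair_mem_samplerAccLang,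
      Set.mem_inter_iff]
    exact and_comm
  rw [hS, hSR]
  exact ⟨hpos, hyes, hno⟩

end Literature.Computability.QuantumComplexity
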